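import Literature.LinearAlgebra.Matrix.ABVersusBAJordanStructure
import Literature.Computability.AlgebraicComplexity.Yab15BRankConcave
import Literature.Computability.AlgebraicComplexity.Yab15BRankPsdSplit
import HarnessLib

/-!
# Yabe 2015, Corollary 2.3 and Proposition 1.8 — discharged

Topic `Literature/Computability/AlgebraicComplexity`; third proofs file for `Yab15BRank.lean`
(A. Yabe, *Bi-polynomial rank and determinantal complexity*, arXiv:1504.00151), assembling
`Yab15BRankConcave.lean` (Lemma 4.1, Thm. 4.5), `Yab15BRankPsdSplit.lean` (the psd splitting
`Q = Q₊ − Q₋` behind Cor. 2.3) and the discharges `yabe2015_thm_2_1_holds` / `yabe2015_cor_2_2_holds`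
of `Yab15BRank.lean` (val-lit t17):

* `yabe2015_cor_2_3_holds` — **Corollary 2.3** (p0005), = `yabe2015_cor_2_3_of_cor_2_2` applied to
  `yabe2015_cor_2_2_holds`.
* `yabe2015_prop_1_8_holds` — **Proposition 1.8** (p0004; proof §4.1 p0010: "combine Cor. 2.3 and
  Thm. 4.5"). As the source's `min`/`minrank` are infima that our typing renders by `sInf` over `ℕ`
  (junk `0` on `∅`), the proof makes the feasibility explicit: a homogeneous `p` of degree `2k` has a
  symmetric Gram matrix `Q` of rank `≤ 2·brank(p)` (`exists_eq_sum_mul_of_isHomogeneous`,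
  `exists_gramPoly_eq_of_eq_sum`, symmetrisation as in Cor. 2.2), which splits as `Q₊ − Q₋` with
  `rank Q₊ + rank Q₋ = rank Q` (`Yabe.exists_posSemidef_sub_rank_add`); the block matrix
  `diag(Q₊, Q₋) ∈ 𝒳_p ∩ Psd_n` then has rank `> r` by Thm. 4.5, and
  `rank diag(Q₊, Q₋) = rank Q₊ + rank Q₋` (tree: `rank_fromBlocks_zero₁₂_zero₂₁`, Horn–Johnson 0.9.2).

No new definitions, no new facts.

## References

* [Yabe2015] A. Yabe, arXiv:1504.00151 (2015): Prop. 1.8 (p0004), Cor. 2.3 (p0005), §4.1 (p0010).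
* [HornJohnson2013] R. A. Horn, C. R. Johnson, *Matrix Analysis*, 2nd ed., §0.9.2 (rank of a direct
  sum).
-/

noncomputable section

open Matrix Finset MvPolynomial

namespace Literature.Computability.AlgebraicComplexity

universe v

namespace Yabe

/-- A block-diagonal matrix with positive semidefinite real blocks is positive semidefinite
(`xᵀ diag(A,D) x = x₁ᵀ A x₁ + x₂ᵀ D x₂`). [cite: HornJohnson2013, Obs. 7.1.3] -/
private theorem posSemidef_fromBlocks_zero {m n : Type v} [Fintype m] [Fintype n]
    {A : Matrix m m ℝ} {D : Matrix n n ℝ} (hA : A.PosSemidef) (hD : D.PosSemidef) :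
    (Matrix.fromBlocks A 0 0 D).PosSemidef := by
  refine PosSemidef.of_dotProduct_mulVec_nonneg (hA.1.fromBlocks (by simp) hD.1) fun x => ?_
  rw [Matrix.fromBlocks_mulVec, Matrix.zero_mulVec, Matrix.zero_mulVec, add_zero, zero_add,
    dotProduct, Fintype.sum_sum_type]
  simp only [Sum.elim_inl, Sum.elim_inr, Pi.star_apply]
  have h1 := hA.dotProduct_mulVec_nonneg (x ∘ Sum.inl)
  have h2 := hD.dotProduct_mulVec_nonneg (x ∘ Sum.inr)
  simp only [dotProduct, Pi.star_apply, Function.comp_apply] at h1 h2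
  exact add_nonneg h1 h2

/-- **Feasibility with the rank bound of Cor. 2.2** (Yabe 2015, p0005, proofs of Thm. 2.1 / Cor. 2.2):
a homogeneous real `p` of degree `2k` has a SYMMETRIC Gram matrix `Q` (`v(x)ᵀ Q v(x) = p`) of rank
`≤ 2·brank(p)`: symmetrise the Gram matrix of an optimal decomposition `p = Σ_{i<brank} f_i g_i`.
[cite: Yabe2015, Corollary 2.2 (proof)] -/
theorem exists_isSymm_gramPoly_rank_le {σ : Type v} [Fintype σ] [DecidableEq σ] {k : ℕ}
    {p : MvPolynomial σ ℝ} (hp : p.IsHomogeneous (2 * k)) :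
    ∃ Q : Matrix (DegIdx σ k) (DegIdx σ k) ℝ, Q.IsSymm ∧ gramPoly k Q = p ∧
      Q.rank ≤ 2 * bRank k p := by
  classical
  obtain ⟨f, g, hf, hg, hfg⟩ := exists_eq_sum_mul_of_isHomogeneous hp
  obtain ⟨Q', hQ'p, hQ'r⟩ := exists_gramPoly_eq_of_eq_sum f g hf hg hfg
  rw [Fintype.card_fin] at hQ'r
  refine ⟨(1 / 2 : ℝ) • (Q' + Q'ᵀ), ?_, ?_, ?_⟩
  · rw [Matrix.IsSymm, Matrix.transpose_smul, Matrix.transpose_add, Matrix.transpose_transpose,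
      add_comm]
  · rw [gramPoly_smul, gramPoly_add, gramPoly_transpose, hQ'p, ← two_smul ℝ p, smul_smul]
    norm_num
  · calc ((1 / 2 : ℝ) • (Q' + Q'ᵀ)).rank ≤ (Q' + Q'ᵀ).rank := by
          have h : (1 / 2 : ℝ) • (Q' + Q'ᵀ) = ((1 / 2 : ℝ) • (1 : Matrix _ _ ℝ)) * (Q' + Q'ᵀ) := by
            rw [Matrix.smul_mul, Matrix.one_mul]
          rw [h]
          exact Matrix.rank_mul_le_right _ _
      _ ≤ Q'.rank + Q'ᵀ.rank := rank_add_le _ _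
      _ ≤ 2 * bRank k p := by rw [Matrix.rank_transpose]; omega

end Yabe

/-- **Yabe 2015, Corollary 2.3 — PROVED** (p0005): for homogeneous `p ∈ ℝ[x]^{(2k)}`, the optimum of
"minimise `rank Q₊ + rank Q₋` over psd pairs with `v(x)ᵀ(Q₊ − Q₋)v(x) = p`" is at most `2·brank(p)`.
Discharges `yabe2015_cor_2_3` (= `yabe2015_cor_2_3_of_cor_2_2 yabe2015_cor_2_2_holds`).
[cite: Yabe2015, Corollary 2.3] -/
theorem yabe2015_cor_2_3_holds : yabe2015_cor_2_3.{v} :=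
  yabe2015_cor_2_3_of_cor_2_2 yabe2015_cor_2_2_holds

/-- **Yabe 2015, Proposition 1.8 — PROVED** (p0004; proof p0010 "Cor. 2.3 + Thm. 4.5"): if
`𝒳_p ∩ Psd_n ⊆ conv(𝒴)` (`n = 2s_k`) for a family `𝒴` of symmetric matrices with `μ_{n−r} > 0`, then
`brank(p) > r/2`. Discharges `yabe2015_prop_1_8`. [cite: Yabe2015, Proposition 1.8] -/
theorem yabe2015_prop_1_8_holds : yabe2015_prop_1_8.{v} := by
  intro σ _ _ k p r hp hY
  classical
  -- a symmetric Gram matrix of rank `≤ 2·brank`, split into psd parts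
  obtain ⟨Q, hQs, hQp, hQr⟩ := Yabe.exists_isSymm_gramPoly_rank_le hp
  obtain ⟨Qp, Qm, hQp', hQm', hsub, hrank⟩ := Yabe.exists_posSemidef_sub_rank_add hQs
  -- the feasible psd block matrix `diag(Q₊, Q₋) ∈ 𝒳_p`
  set M : Matrix (DegIdx σ k ⊕ DegIdx σ k) (DegIdx σ k ⊕ DegIdx σ k) ℝ :=
    Matrix.fromBlocks Qp 0 0 Qm with hM
  have hMmem : M ∈ gramPairSet k p :=
    ⟨Qp, Qm, Matrix.isHermitian_iff_isSymm.mp hQp'.1, Matrix.isHermitian_iff_isSymm.mp hQm'.1, rfl,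
      by rw [hsub]; exact hQp⟩
  have hMpsd : M.PosSemidef := Yabe.posSemidef_fromBlocks_zero hQp' hQm'
  -- Thm. 4.5 on `𝒳 = 𝒳_p ∩ Psd`
  have h45 := yabe2015_thm_4_5_holds (DegIdx σ k ⊕ DegIdx σ k)
    {M | M ∈ gramPairSet k p ∧ M.PosSemidef} r ⟨M, hMmem, hMpsd⟩ (fun X hX => hX.2) hY
  have hrM : r < M.rank := lt_of_lt_of_le h45 (Nat.sInf_le ⟨M, ⟨hMmem, hMpsd⟩, rfl⟩)
  have hMrank : M.rank = Qp.rank + Qm.rank :=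
    Literature.LinearAlgebra.Matrix.rank_fromBlocks_zero₁₂_zero₂₁ Qp Qm
  omega

end Literature.Computability.AlgebraicComplexity

end
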